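import Literature.NumberTheory.LFunctions.SchoenfeldPsiTheta
import Literature.NumberTheory.LFunctions.SchoenfeldExplicit
import HarnessLib

/-!
# The integral `∫ (θ(t) − t) dt/(t log² t)` under RH: explicit bounds via `ψ₁`

Topic: `Literature/NumberTheory/LFunctions`. THEOREMS (everything proved). Step of the discharge of
`Literature.NumberTheory.LFunctions.schoenfeld_explicit` (Schoenfeld 1976, Cor. 1). In the identity
`π(x) − li(x) = (θ(x) − x)/log x + ∫_ξ^x (θ(t) − t)/(t log² t) dt − ξ'`
(`Literature.NumberTheory.LFunctions.primeCounting_sub_logIntegral_eq`, Rosser–Schoenfeld 1962 (4.17)) Schoenfeld bounds the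
integral through `|θ(t) − t| < √t log² t/(8π)` pointwise, which costs `√x/(4π)` and forces the tables
below `23·10⁸`. Here the integral is instead split as `∫ (ψ − t) w − ∫ (ψ − θ) w`, `w(t) = 1/(t log² t)`,
and the first part is integrated by parts against `ψ₁` (whose explicit formula converges
absolutely): with `R₁ = ψ₁ − t²/2` and any constant `c`,
`∫_ξ^x (ψ − t) w = (R₁(x) − c) w(x) − (R₁(ξ) − c) w(ξ) − ∫_ξ^x (R₁ − c) w'`, and under RH
`|R₁(t) − c₀| ≤ β t^{3/2} + (log 2π) t + t/(2(t² − 1))` for `c₀ = Re (ζ'/ζ)(−1)`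
(`NicolasJExplicit.Rone_eq_explicit`, `‖Z(t)‖ ≤ β t^{3/2}`, `0 ≤ c₀ − Re E(t) ≤ t/(2(t²−1))`). Results:

* `integral_psi_sub_mul_w_eq` — the integration by parts (any `c`);
* `abs_Rone_sub_le` — the bound for `|R₁(t) − c₀|` under RH;
* `abs_integral_psi_sub_mul_w_le` — **under RH, for `2 ≤ ξ ≤ x`:
  `|∫_ξ^x (ψ(t) − t) w(t) dt| ≤ B(x)w(x) + B(ξ)w(ξ) + 2βc_ξ(√x − √ξ) + (log 2π + ε_ξ) a_ξ`**,
  `B(t) = βt√t + (log 2π)t + t/(2(t²−1))`, `c_ξ = 1/log²ξ + 2/log³ξ`, `a_ξ = 1/log ξ + 1/log²ξ`,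
  `ε_ξ = 1/(2(ξ²−1))`;
* `psi_sub_theta_le_sqrt` — under RH, `0 ≤ ψ(t) − θ(t) ≤ 1.33 √t` for `t ≥ 10⁴`, and
  `integral_psi_sub_theta_mul_w` — `0 ≤ ∫_ξ^x (ψ − θ) w ≤ 1.33 ∫_ξ^x dt/(√t log² t)`;
* `integral_theta_sub_eq` — `∫ (θ − t) w = ∫ (ψ − t) w − ∫ (ψ − θ) w` (integrability bookkeeping);
* `rpow_third_le`, `rpow_fifth_le` — `t^{1/3} ≤ √t/c` for `t ≥ c⁶`, `t^{1/5} ≤ √t/c³` for `t ≥ c¹⁰`.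

## References

* L. Schoenfeld, Math. Comp. 30 (1976), 337–360, proof of Cor. 1 ((6.19a)–(6.19b)). [Schoenfeld1976]
* J. B. Rosser, L. Schoenfeld, Illinois J. Math. 6 (1962), 64–94, (4.14)–(4.17). [RosserSchoenfeld1962]
* J.-L. Nicolas, Acta Arith. 155 (2012), Lemma 2.5 (the same integration by parts for `J(x)`).
  [Nicolas2012]
-/

noncomputable section

open Real MeasureTheory Set intervalIntegral
open scoped Chebyshev

namespace Literature.NumberTheory.LFunctions

namespace SchoenfeldBound

open NicolasJ NicolasJExplicit

/-! ### The weight `w(t) = 1/(t log² t)` -/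

/-- `w(t) = 1/(t log² t)`. [cite: Schoenfeld1976, (6.19a)] -/
def wt (t : ℝ) : ℝ := (t * Real.log t ^ 2)⁻¹

/-- `w'(t) = −(log t + 2)/(t² log³ t)`. [folklore] -/
def wt' (t : ℝ) : ℝ := -(Real.log t + 2) / (t ^ 2 * Real.log t ^ 3)

/-- `w' = wt'` on `(1, ∞)`. [folklore] -/
theorem hasDerivAt_wt {t : ℝ} (ht : 1 < t) : HasDerivAt wt (wt' t) t := by
  have ht0 : t ≠ 0 := by positivity
  have hl : Real.log t ≠ 0 := (Real.log_pos ht).ne'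
  have h := ((hasDerivAt_id t).mul ((Real.hasDerivAt_log ht0).pow 2)).inv (by
    simpa using mul_ne_zero ht0 (pow_ne_zero 2 hl))
  unfold wt wt'
  refine h.congr_deriv ?_
  simp only [Pi.mul_apply, Pi.pow_apply, id_eq]
  field_simp
  ring

/-- `w > 0` on `(1, ∞)`. [folklore] -/
theorem wt_pos {t : ℝ} (ht : 1 < t) : 0 < wt t := by
  unfold wt; have := Real.log_pos ht; positivity

/-- `|w'(t)| = (log t + 2)/(t² log³ t)` on `(1, ∞)`. [folklore] -/
theorem abs_wt' {t : ℝ} (ht : 1 < t) : |wt' t| = (Real.log t + 2) / (t ^ 2 * Real.log t ^ 3) := by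
  unfold wt'
  have := Real.log_pos ht
  rw [neg_div, abs_neg, abs_of_pos (by positivity)]

/-- `w`, `w'` are continuous on `[a, b]`, `a > 1`. [folklore] -/
theorem continuousOn_wt {a b : ℝ} (ha : 1 < a) :
    ContinuousOn wt (Icc a b) ∧ ContinuousOn wt' (Icc a b) := by
  constructor
  · refine continuousOn_of_forall_continuousAt fun t ht ↦ ?_
    have h1 : 1 < t := ha.trans_le ht.1
    have ht0 : t ≠ 0 := by positivity
    have hl : Real.log t ≠ 0 := (Real.log_pos h1).ne'
    have h2 : t * Real.log t ^ 2 ≠ 0 := by positivity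
    unfold wt
    fun_prop (disch := assumption)
  · refine continuousOn_of_forall_continuousAt fun t ht ↦ ?_
    have h1 : 1 < t := ha.trans_le ht.1
    have ht0 : t ≠ 0 := by positivity
    have hl : Real.log t ≠ 0 := (Real.log_pos h1).ne'
    have h3 : t ^ 2 * Real.log t ^ 3 ≠ 0 := by positivity
    unfold wt'
    fun_prop (disch := assumption)

/-! ### Integration by parts against `ψ₁` -/

/-- **Integration by parts with a constant shift**: for `1 < ξ ≤ x` and any `c`,
`∫_ξ^x (ψ(t) − t) w(t) dt = (R₁(x) − c) w(x) − (R₁(ξ) − c) w(ξ) − ∫_ξ^x (R₁(t) − c) w'(t) dt`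
(`R₁ = ψ₁ − t²/2` has right derivative `ψ − t`; `NicolasJ.hasDerivWithinAt_Rone`). [cite: Nicolas2012, Lemma 2.5 (proof)] -/
theorem integral_psi_sub_mul_w_eq {ξ x : ℝ} (hξ : 1 < ξ) (hξx : ξ ≤ x) (c : ℝ) :
    ∫ t in ξ..x, (ψ t - t) * wt t =
      (Rone x - c) * wt x - (Rone ξ - c) * wt ξ - ∫ t in ξ..x, (Rone t - c) * wt' t := by
  have hIcc : uIcc ξ x = Icc ξ x := uIcc_of_le hξx
  obtain ⟨hwc, hw'c⟩ := continuousOn_wt (a := ξ) (b := x) hξ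
  have hwc' : ContinuousOn wt (uIcc ξ x) := by rwa [hIcc]
  have hw'c' : ContinuousOn wt' (uIcc ξ x) := by rwa [hIcc]
  have hu : ∀ t ∈ Ioo (min ξ x) (max ξ x), HasDerivWithinAt (fun t ↦ Rone t - c) (ψ t - t) (Ioi t) t :=
    fun t _ ↦ by simpa using (hasDerivWithinAt_Rone t).sub_const c
  have h := integral_deriv_mul_eq_sub_of_hasDeriv_right (u := fun t ↦ Rone t - c) (v := wt)
    (u' := fun t ↦ ψ t - t) (v' := wt') (a := ξ) (b := x)
    (continuous_Rone.continuousOn.sub continuousOn_const) hwc' hu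
    (fun t ht ↦ (hasDerivAt_wt (by rw [min_eq_left hξx] at ht; exact hξ.trans ht.1)).hasDerivWithinAt)
    ((intervalIntegrable_psi ξ x).sub intervalIntegrable_id) hw'c'.intervalIntegrable
  have hi1 : IntervalIntegrable (fun t ↦ (ψ t - t) * wt t) volume ξ x :=
    ((intervalIntegrable_psi ξ x).sub intervalIntegrable_id).mul_continuousOn hwc'
  have hi2 : IntervalIntegrable (fun t ↦ (Rone t - c) * wt' t) volume ξ x :=
    hw'c'.intervalIntegrable.continuousOn_mul (continuous_Rone.continuousOn.sub continuousOn_const)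
  rw [integral_add hi1 hi2] at h
  linarith

/-! ### `|R₁(t) − c₀|` under RH -/

/-- The real constant `c₀ = Re (ζ'/ζ)(−1)` of the explicit formula. [cite: MontgomeryVaughan2007, §12.1.1 Exercise 6] -/
def c0 : ℝ := (deriv riemannZeta (-1) / riemannZeta (-1)).re

/-- **Under RH, `|R₁(t) − c₀| ≤ β t√t + (log 2π) t + t/(2(t² − 1))` for `t > 1`**
(`R₁ = −Re Z − (log 2π) t + Re E`, `‖Z(t)‖ ≤ βt^{3/2}`, `0 ≤ c₀ − Re E(t) ≤ t/(2(t²−1))`).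
[cite: MontgomeryVaughan2007, (13.7)–(13.8)] -/
theorem abs_Rone_sub_le (hRH : RiemannHypothesis) {t : ℝ} (ht : 1 < t) :
    |Rone t - c0| ≤ nicolasBeta * (t * Real.sqrt t) + Real.log (2 * π) * t + t / (2 * (t ^ 2 - 1)) := by
  have h := congrArg Complex.re (Rone_eq_explicit ht.le)
  rw [log_two_pi] at h
  simp only [Complex.ofReal_re, Complex.add_re, Complex.sub_re, Complex.neg_re,
    Complex.re_ofReal_mul] at h
  have hZ : ‖Zsum t‖ ≤ nicolasBeta * t ^ (3 / 2 : ℝ) := norm_psiOne_zeroSum_le_of_RH hRH ht.le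
  rw [rpow_three_halves (by linarith)] at hZ
  have hZre : |(Zsum t).re| ≤ ‖Zsum t‖ := Complex.abs_re_le_norm _
  obtain ⟨hE0, hE1⟩ := re_const_sub_psiOneRemainder_mem ht
  have hc : c0 = (deriv riemannZeta (-1) / riemannZeta (-1)).re := rfl
  rw [abs_le]
  constructor
  · have := (abs_le.1 hZre).2
    rw [h, hc]
    nlinarith [Real.log_pos (show (1 : ℝ) < 2 * π by linarith [Real.pi_gt_three])]
  · have := (abs_le.1 hZre).1
    rw [h, hc]
    have : 0 < Real.log (2 * π) * t := by
      have := Real.log_pos (show (1 : ℝ) < 2 * π by linarith [Real.pi_gt_three]); positivity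
    nlinarith

/-- The majorant `B(t) = βt√t + (log 2π)t + t/(2(t²−1))` of `|R₁(t) − c₀|`. [folklore] -/
def Bmaj (t : ℝ) : ℝ := nicolasBeta * (t * Real.sqrt t) + Real.log (2 * π) * t + t / (2 * (t ^ 2 - 1))

/-- `B ≥ 0` on `(1, ∞)`. [folklore] -/
theorem Bmaj_nonneg {t : ℝ} (ht : 1 < t) : 0 ≤ Bmaj t := by
  unfold Bmaj
  have := nicolasBeta_gt
  have := Real.log_pos (show (1 : ℝ) < 2 * π by linarith [Real.pi_gt_three])
  have : 0 < t ^ 2 - 1 := by nlinarith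
  positivity

/-! ### The two elementary integrals -/

/-- `∫_ξ^x dt/√t = 2√x − 2√ξ` (`0 < ξ ≤ x`). [folklore] -/
theorem integral_inv_sqrt {ξ x : ℝ} (hξ : 0 < ξ) (hξx : ξ ≤ x) :
    ∫ t in ξ..x, (Real.sqrt t)⁻¹ = 2 * Real.sqrt x - 2 * Real.sqrt ξ := by
  have hderiv : ∀ t ∈ uIcc ξ x, HasDerivAt (fun t ↦ 2 * Real.sqrt t) ((Real.sqrt t)⁻¹) t := by
    intro t ht
    rw [uIcc_of_le hξx] at ht
    have ht0 : 0 < t := hξ.trans_le ht.1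
    have h := (Real.hasDerivAt_sqrt ht0.ne').const_mul 2
    refine h.congr_deriv ?_
    have : 0 < Real.sqrt t := Real.sqrt_pos.2 ht0
    field_simp
  have hcont : ContinuousOn (fun t ↦ (Real.sqrt t)⁻¹) (uIcc ξ x) := by
    refine continuousOn_of_forall_continuousAt fun t ht ↦ ?_
    rw [uIcc_of_le hξx] at ht
    have : Real.sqrt t ≠ 0 := (Real.sqrt_pos.2 (hξ.trans_le ht.1)).ne'
    fun_prop (disch := assumption)
  rw [integral_eq_sub_of_hasDerivAt hderiv hcont.intervalIntegrable]

/-- `∫_ξ^x (log t + 2) dt/(t log³ t) = (1/log ξ + 1/log² ξ) − (1/log x + 1/log² x)` (`1 < ξ ≤ x`). [folklore] -/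
theorem integral_log_add_two_div {ξ x : ℝ} (hξ : 1 < ξ) (hξx : ξ ≤ x) :
    ∫ t in ξ..x, (Real.log t + 2) / (t * Real.log t ^ 3) =
      ((Real.log ξ)⁻¹ + (Real.log ξ ^ 2)⁻¹) - ((Real.log x)⁻¹ + (Real.log x ^ 2)⁻¹) := by
  have hderiv : ∀ t ∈ uIcc ξ x, HasDerivAt (fun t ↦ -((Real.log t)⁻¹ + (Real.log t ^ 2)⁻¹))
      ((Real.log t + 2) / (t * Real.log t ^ 3)) t := by
    intro t ht
    rw [uIcc_of_le hξx] at ht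
    have h1 : 1 < t := hξ.trans_le ht.1
    have ht0 : t ≠ 0 := by positivity
    have hl : Real.log t ≠ 0 := (Real.log_pos h1).ne'
    have hlog := Real.hasDerivAt_log ht0
    have h := (hlog.inv hl).add ((hlog.pow 2).inv (by simpa using pow_ne_zero 2 hl)) |>.neg
    refine h.congr_deriv ?_
    simp only [Pi.pow_apply]
    field_simp
    ring
  have hcont : ContinuousOn (fun t ↦ (Real.log t + 2) / (t * Real.log t ^ 3)) (uIcc ξ x) := by
    refine continuousOn_of_forall_continuousAt fun t ht ↦ ?_
    rw [uIcc_of_le hξx] at ht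
    have h1 : 1 < t := hξ.trans_le ht.1
    have ht0 : t ≠ 0 := by positivity
    have hl : Real.log t ≠ 0 := (Real.log_pos h1).ne'
    have : t * Real.log t ^ 3 ≠ 0 := by positivity
    fun_prop (disch := assumption)
  rw [integral_eq_sub_of_hasDerivAt hderiv hcont.intervalIntegrable]
  ring

/-! ### The bound for `∫ (ψ − t) w` -/

/-- **Under RH, for `2 ≤ ξ ≤ x`:
`|∫_ξ^x (ψ(t) − t) w(t) dt| ≤ B(x)w(x) + B(ξ)w(ξ) + 2βc_ξ(√x − √ξ) + (log 2π + ε_ξ)·a_ξ`**,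
where `c_ξ = 1/log²ξ + 2/log³ξ`, `a_ξ = 1/log ξ + 1/log²ξ`, `ε_ξ = 1/(2(ξ²−1))`: integration by
parts with `c = c₀`, `|R₁ − c₀| ≤ B`, and `B(t)|w'(t)| ≤ βc_ξ/√t + (log 2π + ε_ξ)(log t + 2)/(t log³t)`
on `[ξ, x]`. [cite: Schoenfeld1976, proof of Cor. 1 (the integral term, via ψ₁)] -/
theorem abs_integral_psi_sub_mul_w_le (hRH : RiemannHypothesis) {ξ x : ℝ} (hξ : 2 ≤ ξ) (hξx : ξ ≤ x) :
    |∫ t in ξ..x, (ψ t - t) * wt t| ≤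
      Bmaj x * wt x + Bmaj ξ * wt ξ +
        2 * nicolasBeta * ((Real.log ξ ^ 2)⁻¹ + 2 * (Real.log ξ ^ 3)⁻¹) * (Real.sqrt x - Real.sqrt ξ) +
        (Real.log (2 * π) + (2 * (ξ ^ 2 - 1))⁻¹) * ((Real.log ξ)⁻¹ + (Real.log ξ ^ 2)⁻¹) := by
  have hξ1 : 1 < ξ := by linarith
  have hx1 : 1 < x := by linarith
  have hIcc : uIcc ξ x = Icc ξ x := uIcc_of_le hξx
  set cξ : ℝ := (Real.log ξ ^ 2)⁻¹ + 2 * (Real.log ξ ^ 3)⁻¹ with hcξ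
  set aξ : ℝ := (Real.log ξ)⁻¹ + (Real.log ξ ^ 2)⁻¹ with haξ
  set εξ : ℝ := (2 * (ξ ^ 2 - 1))⁻¹ with hεξ
  have hβ := nicolasBeta_gt
  have hL2 : 0 < Real.log (2 * π) := Real.log_pos (by linarith [Real.pi_gt_three])
  have hlξ : 0 < Real.log ξ := Real.log_pos hξ1
  have hξ21 : 0 < ξ ^ 2 - 1 := by nlinarith
  rw [integral_psi_sub_mul_w_eq hξ1 hξx c0]
  -- the two boundary terms
  have hbx : |(Rone x - c0) * wt x| ≤ Bmaj x * wt x := by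
    rw [abs_mul, abs_of_pos (wt_pos hx1)]
    exact mul_le_mul_of_nonneg_right (abs_Rone_sub_le hRH hx1) (wt_pos hx1).le
  have hbξ : |(Rone ξ - c0) * wt ξ| ≤ Bmaj ξ * wt ξ := by
    rw [abs_mul, abs_of_pos (wt_pos hξ1)]
    exact mul_le_mul_of_nonneg_right (abs_Rone_sub_le hRH hξ1) (wt_pos hξ1).le
  -- the integral term: pointwise majorant
  have hmaj : ∀ t ∈ Icc ξ x, |(Rone t - c0) * wt' t| ≤
      nicolasBeta * cξ * (Real.sqrt t)⁻¹ + (Real.log (2 * π) + εξ) * ((Real.log t + 2) / (t * Real.log t ^ 3)) := by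
    intro t ht
    have ht1 : 1 < t := hξ1.trans_le ht.1
    have ht0 : 0 < t := by linarith
    have hlt : 0 < Real.log t := Real.log_pos ht1
    have hst : 0 < Real.sqrt t := Real.sqrt_pos.2 ht0
    have hsst : Real.sqrt t * Real.sqrt t = t := Real.mul_self_sqrt ht0.le
    rw [abs_mul, abs_wt' ht1]
    have hR := abs_Rone_sub_le hRH ht1
    -- `log ξ ≤ log t`, so `1/log² t + 2/log³ t ≤ cξ`; `t/(2(t²−1)) ≤ εξ t`
    have hlog : Real.log ξ ≤ Real.log t := Real.log_le_log (by linarith) ht.1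
    have hc1 : (Real.log t ^ 2)⁻¹ ≤ (Real.log ξ ^ 2)⁻¹ :=
      inv_anti₀ (by positivity) (pow_le_pow_left₀ hlξ.le hlog 2)
    have hc2 : (Real.log t ^ 3)⁻¹ ≤ (Real.log ξ ^ 3)⁻¹ :=
      inv_anti₀ (by positivity) (pow_le_pow_left₀ hlξ.le hlog 3)
    have hε : t / (2 * (t ^ 2 - 1)) ≤ εξ * t := by
      rw [hεξ, div_eq_mul_inv, mul_comm]
      refine mul_le_mul_of_nonneg_right (inv_anti₀ (by positivity) ?_) ht0.le
      nlinarith [ht.1]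
    -- assemble: |R₁ − c₀| (log t + 2)/(t² log³ t) ≤ …
    have hw'0 : 0 ≤ (Real.log t + 2) / (t ^ 2 * Real.log t ^ 3) := by positivity
    calc |Rone t - c0| * ((Real.log t + 2) / (t ^ 2 * Real.log t ^ 3))
        ≤ (nicolasBeta * (t * Real.sqrt t) + Real.log (2 * π) * t + εξ * t) *
            ((Real.log t + 2) / (t ^ 2 * Real.log t ^ 3)) := by
          refine mul_le_mul_of_nonneg_right (hR.trans ?_) hw'0
          linarith
      _ = nicolasBeta * ((Real.log t ^ 2)⁻¹ + 2 * (Real.log t ^ 3)⁻¹) * (Real.sqrt t)⁻¹ +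
            (Real.log (2 * π) + εξ) * ((Real.log t + 2) / (t * Real.log t ^ 3)) := by
          field_simp
          nlinarith [hsst]
      _ ≤ nicolasBeta * cξ * (Real.sqrt t)⁻¹ +
            (Real.log (2 * π) + εξ) * ((Real.log t + 2) / (t * Real.log t ^ 3)) := by
          have : (Real.log t ^ 2)⁻¹ + 2 * (Real.log t ^ 3)⁻¹ ≤ cξ := by rw [hcξ]; linarith
          gcongr
  -- integrate the majorant
  obtain ⟨hwc, hw'c⟩ := continuousOn_wt (a := ξ) (b := x) hξ1
  have hint_f : IntervalIntegrable (fun t ↦ (Rone t - c0) * wt' t) volume ξ x :=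
    (hw'c.intervalIntegrable_of_Icc hξx).continuousOn_mul
      (continuous_Rone.continuousOn.sub continuousOn_const)
  have hcont_g : ContinuousOn (fun t ↦ nicolasBeta * cξ * (Real.sqrt t)⁻¹ +
      (Real.log (2 * π) + εξ) * ((Real.log t + 2) / (t * Real.log t ^ 3))) (Icc ξ x) := by
    refine continuousOn_of_forall_continuousAt fun t ht ↦ ?_
    have ht1 : 1 < t := hξ1.trans_le ht.1
    have ht0 : t ≠ 0 := by positivity
    have hl : Real.log t ≠ 0 := (Real.log_pos ht1).ne'
    have hs : Real.sqrt t ≠ 0 := (Real.sqrt_pos.2 (by positivity)).ne'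
    have : t * Real.log t ^ 3 ≠ 0 := by positivity
    fun_prop (disch := assumption)
  have hI : |∫ t in ξ..x, (Rone t - c0) * wt' t| ≤
      nicolasBeta * cξ * (2 * Real.sqrt x - 2 * Real.sqrt ξ) + (Real.log (2 * π) + εξ) * aξ := by
    calc |∫ t in ξ..x, (Rone t - c0) * wt' t|
        ≤ ∫ t in ξ..x, |(Rone t - c0) * wt' t| := abs_integral_le_integral_abs hξx
      _ ≤ ∫ t in ξ..x, (nicolasBeta * cξ * (Real.sqrt t)⁻¹ +
            (Real.log (2 * π) + εξ) * ((Real.log t + 2) / (t * Real.log t ^ 3))) :=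
          integral_mono_on hξx hint_f.abs (hcont_g.intervalIntegrable_of_Icc hξx) hmaj
      _ = nicolasBeta * cξ * (2 * Real.sqrt x - 2 * Real.sqrt ξ) +
            (Real.log (2 * π) + εξ) * (aξ - ((Real.log x)⁻¹ + (Real.log x ^ 2)⁻¹)) := by
          rw [intervalIntegral.integral_add, intervalIntegral.integral_const_mul, intervalIntegral.integral_const_mul,
            integral_inv_sqrt (by linarith) hξx, integral_log_add_two_div hξ1 hξx]
          · exact (continuousOn_of_forall_continuousAt fun t ht ↦ by
              rw [hIcc] at ht
              have hs : Real.sqrt t ≠ 0 := (Real.sqrt_pos.2 (by linarith [ht.1])).ne'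
              fun_prop (disch := assumption)).intervalIntegrable
          · exact (continuousOn_of_forall_continuousAt fun t ht ↦ by
              rw [hIcc] at ht
              have ht1 : 1 < t := hξ1.trans_le ht.1
              have ht0 : t ≠ 0 := by positivity
              have hl : Real.log t ≠ 0 := (Real.log_pos ht1).ne'
              have : t * Real.log t ^ 3 ≠ 0 := by positivity
              fun_prop (disch := assumption)).intervalIntegrable
      _ ≤ nicolasBeta * cξ * (2 * Real.sqrt x - 2 * Real.sqrt ξ) + (Real.log (2 * π) + εξ) * aξ := by
          have hlx : 0 < Real.log x := Real.log_pos hx1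
          have : 0 ≤ (Real.log x)⁻¹ + (Real.log x ^ 2)⁻¹ := by positivity
          have : 0 ≤ Real.log (2 * π) + εξ := by positivity
          nlinarith
  have habs1 : |(Rone x - c0) * wt x - (Rone ξ - c0) * wt ξ - ∫ t in ξ..x, (Rone t - c0) * wt' t| ≤
      |(Rone x - c0) * wt x - (Rone ξ - c0) * wt ξ| + |∫ t in ξ..x, (Rone t - c0) * wt' t| := abs_sub _ _
  have habs2 : |(Rone x - c0) * wt x - (Rone ξ - c0) * wt ξ| ≤
      |(Rone x - c0) * wt x| + |(Rone ξ - c0) * wt ξ| := abs_sub _ _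
  have e : nicolasBeta * cξ * (2 * Real.sqrt x - 2 * Real.sqrt ξ) =
      2 * nicolasBeta * cξ * (Real.sqrt x - Real.sqrt ξ) := by ring
  linarith

/-! ### `ψ − θ` on `[10⁴, ∞)` and the integral of `(ψ − θ) w` -/

/-- `t^{1/3} ≤ √t/c` whenever `0 < c` and `c⁶ ≤ t` (with `u = t^{1/6}`: `u ≥ c`, `t^{1/3} = u²`, `√t = u³`).
[folklore] -/
theorem rpow_third_le {c t : ℝ} (hc : 0 < c) (ht : c ^ 6 ≤ t) : t ^ (1 / 3 : ℝ) ≤ Real.sqrt t / c := by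
  have ht0 : 0 ≤ t := le_trans (by positivity) ht
  set u : ℝ := t ^ (1 / 6 : ℝ) with hu
  have hu0 : 0 ≤ u := Real.rpow_nonneg ht0 _
  have hu6 : u ^ 6 = t := by
    rw [hu, ← Real.rpow_natCast, ← Real.rpow_mul ht0]; norm_num
  have hu2 : u ^ 2 = t ^ (1 / 3 : ℝ) := by
    rw [hu, ← Real.rpow_natCast, ← Real.rpow_mul ht0]; norm_num
  have hu3 : u ^ 3 = Real.sqrt t := by
    rw [hu, ← Real.rpow_natCast, ← Real.rpow_mul ht0, Real.sqrt_eq_rpow]; norm_num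
  have hcu : c ≤ u := by
    by_contra h
    rw [not_le] at h
    have : u ^ 6 < c ^ 6 := pow_lt_pow_left₀ h hu0 (by norm_num)
    linarith
  rw [← hu2, ← hu3, le_div_iff₀ hc]
  nlinarith [pow_nonneg hu0 2]

/-- `t^{1/5} ≤ √t/c³` whenever `0 < c` and `c¹⁰ ≤ t` (with `v = t^{1/10}`: `v ≥ c`, `t^{1/5} = v²`,
`√t = v⁵`). [folklore] -/
theorem rpow_fifth_le {c t : ℝ} (hc : 0 < c) (ht : c ^ 10 ≤ t) : t ^ (1 / 5 : ℝ) ≤ Real.sqrt t / c ^ 3 := by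
  have ht0 : 0 ≤ t := le_trans (by positivity) ht
  set v : ℝ := t ^ (1 / 10 : ℝ) with hv
  have hv0 : 0 ≤ v := Real.rpow_nonneg ht0 _
  have hv10 : v ^ 10 = t := by
    rw [hv, ← Real.rpow_natCast, ← Real.rpow_mul ht0]; norm_num
  have hv2 : v ^ 2 = t ^ (1 / 5 : ℝ) := by
    rw [hv, ← Real.rpow_natCast, ← Real.rpow_mul ht0]; norm_num
  have hv5 : v ^ 5 = Real.sqrt t := by
    rw [hv, ← Real.rpow_natCast, ← Real.rpow_mul ht0, Real.sqrt_eq_rpow]; norm_num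
  have hcv : c ≤ v := by
    by_contra h
    rw [not_le] at h
    have : v ^ 10 < c ^ 10 := pow_lt_pow_left₀ h hv0 (by norm_num)
    linarith
  rw [← hv2, ← hv5, le_div_iff₀ (by positivity)]
  have h3 : c ^ 3 ≤ v ^ 3 := pow_le_pow_left₀ hc.le hcv 3
  nlinarith [pow_nonneg hv0 2, pow_nonneg hv0 3]

/-- **Under RH, `0 ≤ ψ(t) − θ(t) ≤ 1.33 √t` for `t ≥ 10⁴`** (`ψ − θ ≤ 1.04(√t + t^{1/3} + t^{1/5})`,
`t^{1/3} ≤ √t/4.64`, `t^{1/5} ≤ √t/2.511³` there). [cite: RosserSchoenfeld1962, (3.39)] -/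
theorem psi_sub_theta_le_sqrt (hRH : RiemannHypothesis) {t : ℝ} (ht : 10000 ≤ t) :
    0 ≤ ψ t - θ t ∧ ψ t - θ t ≤ 1.33 * Real.sqrt t := by
  refine ⟨sub_nonneg.2 (Chebyshev.theta_le_psi t), ?_⟩
  have h := psi_sub_theta_le hRH (x := t) (by linarith)
  have h3 := rpow_third_le (c := 4.64) (t := t) (by norm_num) (by norm_num at ht ⊢; linarith)
  have h5 := rpow_fifth_le (c := 2.511) (t := t) (by norm_num) (by norm_num at ht ⊢; linarith)
  have hs : 0 ≤ Real.sqrt t := Real.sqrt_nonneg t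
  have h3' : t ^ (1 / 3 : ℝ) ≤ 0.21552 * Real.sqrt t := by
    refine h3.trans ?_; rw [div_le_iff₀ (by norm_num)]; nlinarith
  have h5' : t ^ (1 / 5 : ℝ) ≤ 0.0632 * Real.sqrt t := by
    refine h5.trans ?_; rw [div_le_iff₀ (by norm_num)]; nlinarith
  nlinarith

/-- `ψ − θ` times `w` is interval integrable (monotone functions times a continuous weight). [folklore] -/
theorem intervalIntegrable_psi_sub_theta_mul {a b : ℝ} (ha : 1 < a) (hab : a ≤ b) :
    IntervalIntegrable (fun t ↦ (ψ t - θ t) * wt t) volume a b := by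
  have hIcc : uIcc a b = Icc a b := uIcc_of_le hab
  have hw : ContinuousOn wt (uIcc a b) := by rw [hIcc]; exact (continuousOn_wt ha).1
  exact ((Chebyshev.psi_mono.intervalIntegrable).sub
    (Chebyshev.theta_mono.intervalIntegrable)).mul_continuousOn hw

/-- **Under RH, for `10⁴ ≤ ξ ≤ x`: `0 ≤ ∫_ξ^x (ψ − θ) w ≤ 1.33 ∫_ξ^x dt/(√t log² t)`.**
[cite: Schoenfeld1976, proof of Cor. 1] -/
theorem integral_psi_sub_theta_mul_w (hRH : RiemannHypothesis) {ξ x : ℝ} (hξ : 10000 ≤ ξ) (hξx : ξ ≤ x) :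
    0 ≤ ∫ t in ξ..x, (ψ t - θ t) * wt t ∧
      ∫ t in ξ..x, (ψ t - θ t) * wt t ≤ 1.33 * ∫ t in ξ..x, (Real.sqrt t * Real.log t ^ 2)⁻¹ := by
  have hξ1 : 1 < ξ := by linarith
  have hIcc : uIcc ξ x = Icc ξ x := uIcc_of_le hξx
  have hint := intervalIntegrable_psi_sub_theta_mul hξ1 hξx
  have hcont : ContinuousOn (fun t ↦ (Real.sqrt t * Real.log t ^ 2)⁻¹) (Icc ξ x) := by
    refine continuousOn_of_forall_continuousAt fun t ht ↦ ?_
    have ht1 : 1 < t := hξ1.trans_le ht.1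
    have ht0 : t ≠ 0 := by positivity
    have hl : Real.log t ≠ 0 := (Real.log_pos ht1).ne'
    have hs : Real.sqrt t ≠ 0 := (Real.sqrt_pos.2 (by linarith)).ne'
    have : Real.sqrt t * Real.log t ^ 2 ≠ 0 := by positivity
    fun_prop (disch := assumption)
  constructor
  · refine integral_nonneg hξx fun t ht ↦ mul_nonneg (sub_nonneg.2 (Chebyshev.theta_le_psi t)) ?_
    exact (wt_pos (hξ1.trans_le ht.1)).le
  · rw [← intervalIntegral.integral_const_mul]
    refine integral_mono_on hξx hint ((hcont.intervalIntegrable_of_Icc hξx).const_mul _) fun t ht ↦ ?_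
    have ht1 : 1 < t := hξ1.trans_le ht.1
    have ht0 : 0 < t := by linarith
    obtain ⟨-, hD⟩ := psi_sub_theta_le_sqrt hRH (hξ.trans ht.1)
    have hlt : 0 < Real.log t := Real.log_pos ht1
    have hst : 0 < Real.sqrt t := Real.sqrt_pos.2 ht0
    have hsst : Real.sqrt t * Real.sqrt t = t := Real.mul_self_sqrt ht0.le
    have e : 1.33 * (Real.sqrt t * Real.log t ^ 2)⁻¹ = (1.33 * Real.sqrt t) * wt t := by
      unfold wt; field_simp; nlinarith [hsst]
    rw [e]
    exact mul_le_mul_of_nonneg_right hD (wt_pos ht1).le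

/-- `(θ − t) w` is interval integrable on `[a, b] ⊂ (1, ∞)`. [folklore] -/
theorem intervalIntegrable_theta_sub_mul {a b : ℝ} (ha : 1 < a) (hab : a ≤ b) :
    IntervalIntegrable (fun t ↦ (θ t - t) * wt t) volume a b := by
  have hIcc : uIcc a b = Icc a b := uIcc_of_le hab
  have hw : ContinuousOn wt (uIcc a b) := by rw [hIcc]; exact (continuousOn_wt ha).1
  exact ((Chebyshev.theta_mono.intervalIntegrable).sub intervalIntegrable_id).mul_continuousOn hw

/-- **`∫_ξ^x (θ − t) w = ∫_ξ^x (ψ − t) w − ∫_ξ^x (ψ − θ) w`** (`1 < ξ ≤ x`), and the integrand of the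
tree's identity `primeCounting_sub_logIntegral_eq` is `(θ − t) w`. [folklore] -/
theorem integral_theta_sub_eq {ξ x : ℝ} (hξ : 1 < ξ) (hξx : ξ ≤ x) :
    ∫ t in ξ..x, (θ t - t) / (t * Real.log t ^ 2) =
      (∫ t in ξ..x, (ψ t - t) * wt t) - ∫ t in ξ..x, (ψ t - θ t) * wt t := by
  have hIcc : uIcc ξ x = Icc ξ x := uIcc_of_le hξx
  have hw : ContinuousOn wt (uIcc ξ x) := by rw [hIcc]; exact (continuousOn_wt hξ).1
  have h1 : IntervalIntegrable (fun t ↦ (ψ t - t) * wt t) volume ξ x :=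
    ((Chebyshev.psi_mono.intervalIntegrable).sub intervalIntegrable_id).mul_continuousOn hw
  have h2 := intervalIntegrable_psi_sub_theta_mul hξ hξx
  rw [← integral_sub h1 h2]
  refine integral_congr fun t _ ↦ ?_
  simp only [wt, div_eq_mul_inv]
  ring

end SchoenfeldBound

end Literature.NumberTheory.LFunctions

end
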